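import Summits.AtomisticToContinuum.Crystallization.Theorems.ExcessDecayLiouvilleMassInductionStep
import Summits.AtomisticToContinuum.Crystallization.Theorems.ExcessDecayLiouvilleInductionStepAAbs
import Summits.AtomisticToContinuum.Crystallization.Theorems.ExcessDecayLiouvilleStepValues
import Summits.AtomisticToContinuum.Crystallization.Theorems.ExcessDecayLiouvilleScaleDefs

/-!
# Route `ExcessDecayLiouville`: one scale of the excess-decay induction, packaged (nonlinear half, XXXVII)

Harmonic-replacement architecture for item `ExcessDecay` (stmt-AtomisticToContinuum-9334), nonlinear half.
`scale_step` glues `step_correction_abs` (the Dirichlet correction `w` and its energy), `NN_le_poly_abs`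
(the gradient quintic), `farMass_le_mass`, `step_values` (base values of `h = v + w` by the harmonic sup
estimate) and `induction_step₃` into ONE statement about a relaxed approximant `aff` at scale `ρ` about a centre
`c₀ ∈ B_{r/8}(c)`: its numerical inputs are the mass constant `C` (`𝐌[v, X] ≤ 32 C X⁶` on `max(1,ρ) ≤ X ≤ r/4`),
the crude bounds `Du, Dv`, the global gradient bound `N_tot`, and three smallness hypotheses on the NAMED
currencies of `ScaleDefs` (`thetaOneOf`, `thetaTwoOf`, `vsqOf`, `jhOf`, `jumpOf`); its output is the new relaxed
approximant `aff + T + 𝟙_{S₀}ξ` with its data, the bounds of `‖Bᵀ‖`, of the optical jump, of the values `aᵀ m`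
and of the shift `ξ` in the named currencies, the correction `w` with `Σ'‖w‖² ≤ wsqOf …`, and the quartic
pointwise envelope of `χ(u − aff′) + w` on the sites of `B_ρ(c₀)`.
All `[folklore]`; helper lemmas, nothing here closes an item.
-/

noncomputable section

namespace Summit.AtomisticToContinuum.Crystallization.Theorems.ExcessDecayLiouville

open scoped BigOperators Topology InnerProductSpace RealInnerProductSpace Classical
open Literature.MathematicalPhysics.StatisticalMechanics
open Summit.AtomisticToContinuum.Crystallization.Theorems.PhononStabilityNegative

local notation "E3" => EuclideanSpace ℝ (Fin 3)

-- Local notation: the force-constant map `K(e)w = h(|e|²)w + 2⟪e,w⟫h′(|e|²)e`.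
local notation3 "𝕂[" e "] " w:max =>
  (-((‖e‖ ^ 2)⁻¹) ^ 7 + ((‖e‖ ^ 2)⁻¹) ^ 4) • w + (2 * ⟪e, w⟫ * (7 * ((‖e‖ ^ 2)⁻¹) ^ 8 - 4 * ((‖e‖ ^ 2)⁻¹) ^ 5)) • e
-- Local notation: the pair force `F(x) = h(|x|²) x`.
local notation3 "𝐅[" x "]" => ((-((‖x‖ ^ 2)⁻¹) ^ 7 + ((‖x‖ ^ 2)⁻¹) ^ 4) • x)
set_option quotPrecheck false in
-- Local notation: ball indicator.
local notation "𝟙ᵇ[" x ", " c ", " R "]" => (if dist (x : EuclideanSpace ℝ (Fin 3)) c ≤ R then (1 : ℝ) else 0)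
-- the constants of one level in mass form
local notation "Cₐ" => (19 * (1024 / ((23 / 25 : ℝ) ^ 3 * (23 / 25 : ℝ) ^ 3)) + 38 * (1024 / (23 / 25 : ℝ) ^ 3))
local notation "Cⱼ" => (9961472 : ℝ)
-- the two Lipschitz constants of the natural force
local notation "Cˢ" => (38 * (25 / 23) * (1024 / ((23 / 25 : ℝ) ^ 3 * (23 / 25 : ℝ) ^ 4)) +
  (1024 / ((23 / 25 : ℝ) ^ 3 * (23 / 25 : ℝ) ^ 4)) * ((25 / 23 : ℝ) ^ 2 * (72 + 2000)))
local notation "Cᴮ" => (5660 * (1024 / ((23 / 25 : ℝ) ^ 3 * (23 / 25 : ℝ) ^ 3)))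
-- the gradient currency as a quintic: coefficients (as in `StepEnergyBound`)
local notation "𝔮₁[" κ ", " Λ' ", " C "]" => ((64 * (2 / κ) * (131072 * (38 * 4 ^ 5 * (1024 / (23 / 25 : ℝ) ^ 3)) +
          Λ' * 3200000 * (1024 / (23 / 25 : ℝ) ^ 3) * 72704) * C + 64 * 120 ^ 5 * 327680 * C +
        4 / κ * (Λ' * 32768 * 256 * C + 1245184 * 4096 * C)))
local notation "𝔮₂[" κ ", " Λ' ", " Dv ", " r "]" => ((4 / κ * (Λ' * 32768 * 8192 * (7 * r / 8) ^ 3 * Dv ^ 2 / ((r / 4) ^ 7 * 4) +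
        1245184 * 8192 * (7 * r / 8) ^ 3 * Dv ^ 2 / (r / 4) ^ 7)))
local notation "𝔮₃[" κ ", " Λ' ", " D₀ ", " r "]" => ((4 / κ * (Λ' * 32768 * (32 * r ^ 3 * ((3 * r / 8)⁻¹ ^ 8 * (D₀ / 2) ^ 2)))))
local notation "𝔮₄[" κ ", " C "]" => ((2 ^ (5 + 1) * (2 / κ * (19 * 16 * (1024 / ((23 / 25 : ℝ) ^ 3 * (23 / 25 : ℝ) ^ 3))) +
        16 * (11 / 10 : ℝ) ^ 8 * (1024 / ((23 / 25 : ℝ) ^ 3 * (23 / 25 : ℝ) ^ 3))) * (32 * 4 ^ 6) * C))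
local notation "𝔮₅[" κ ", " C ", " Φ₀ "]" => ((4 / κ * (16 * Real.sqrt (2048 * C) * Φ₀)))
set_option quotPrecheck false in
-- the forcing constant on `B_{r/4}(c)`
local notation "𝚽[" Du ", " r ", " δ "]" => (31488 * (1024 / ((23 / 25 : ℝ) ^ 3 * (r / 2) ^ 4)) + 2048 / (δ ^ 3 * (r / 4) ^ 4) +
        (38 * Du * (1024 / ((23 / 25 : ℝ) ^ 3 * (r / 4) ^ 5)) + 38 * Du * (1024 / ((23 / 25 : ℝ) ^ 3 * (r / 2) ^ 5))))

section

variable {X : Set E3} {c : E3} {r ε δ κ : ℝ} {t : Fin 2 → E3} {A : E3 →L[ℝ] E3} {π : E3 → E3}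
  {aff : E3 → E3} {a : Fin 2 → E3} {B : E3 →L[ℝ] E3} {c₀ : E3}

variable (hA : Adm₀ A) (hI : Inner₀ t A)

set_option quotPrecheck false in
-- Local notation: the operator row `(L v)(p)`.
local notation "𝕃" v:max " @ " p:max =>
  tsum (fun q : Sites₀ t A => (if ((p : Sites₀ t A) : E3) ≠ q then 𝕂[((p : Sites₀ t A) : E3) - q] (v ((p : Sites₀ t A) : E3) - v q) else 0))
set_option quotPrecheck false in
-- Local notation: the finite near-neighbour form on the ball of radius `X` about `c₀`.
local notation "NN[" v ", " X "]" =>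
  (∑ p ∈ (finite_sites_dist_le (t := t) (A := A) hA hI c₀ X).toFinset,
    ∑ q ∈ (finite_sites_dist_le (t := t) (A := A) hA hI c₀ X).toFinset,
      (if p ≠ q ∧ dist p q ≤ 11 / 10 then ‖v p - v q‖ ^ 2 else (0 : ℝ)))
set_option quotPrecheck false in
-- local mass on the ball of radius `X` about `c₀`
local notation "𝐌[" f ", " X "]" =>
  tsum (fun p : Sites₀ t A => ‖f (p : E3)‖ ^ 2 * 𝟙ᵇ[p, c₀, X])
set_option quotPrecheck false in
-- the level constant `L = (4Cₐ + 24Cⱼ)/κ + 1`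
local notation "𝐋" => ((4 * Cₐ + 24 * Cⱼ) / κ + 1)
set_option quotPrecheck false in
-- Local notation: the displaced self-force `G(p)` of the background `aff`.
local notation "𝐆[" aff "] " p:max =>
  tsum (fun q : Sites₀ t A => (if (p : E3) ≠ q then 𝐅[((p : E3) - q) + (aff (p : E3) - aff q)] else 0))

set_option quotPrecheck false in
-- weighted far mass about `c₀`
local notation "𝐉[" f ", " Y "]" =>
  tsum (fun q : Sites₀ t A => ‖f (q : E3)‖ ^ 2 * (max (dist (q : E3) c₀) Y)⁻¹ ^ 8)

/-- Nonnegativity of the gradient-quintic coefficients and of the named currencies. [folklore] -/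
theorem quinticOf_nonneg {κ C r δ Du Dv j b x : ℝ} (hκ : 0 < κ) (hC : 0 ≤ C) (hr : 0 < r)
    (hDu : 0 ≤ Du) (hj : 0 ≤ j) (hb : 0 ≤ b) (hx : 0 ≤ x) :
    0 ≤ qOf₁ κ (lamOf Du j b) C ∧ 0 ≤ qOf₂ κ (lamOf Du j b) Dv r ∧ 0 ≤ qOf₃ κ (lamOf Du j b) (2 * Du) r ∧
      0 ≤ qOf₄ κ C ∧ 0 ≤ qOf₅ κ (phiOf Du r δ) ∧ 0 ≤ quinticOf κ C r δ Du Dv j b x := by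
  have hΛ : 0 ≤ lamOf Du j b := by unfold lamOf; positivity
  have h1 : 0 ≤ qOf₁ κ (lamOf Du j b) C := by unfold qOf₁; positivity
  have h2 : 0 ≤ qOf₂ κ (lamOf Du j b) Dv r := by unfold qOf₂; positivity
  have h3 : 0 ≤ qOf₃ κ (lamOf Du j b) (2 * Du) r := by unfold qOf₃; positivity
  have h4 : 0 ≤ qOf₄ κ C := by unfold qOf₄; positivity
  have h5 : 0 ≤ qOf₅ κ (phiOf Du r δ) := by unfold qOf₅; positivity
  refine ⟨h1, h2, h3, h4, h5, ?_⟩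
  unfold quinticOf; positivity

/-- Nonnegativity of `ewOf`, `wsqOf`, `pyOf`, `thetaTwoOf`. [folklore] -/
theorem currencies_nonneg {κ ρ C r δ Du Dv j b Ntot : ℝ} (hκ : 0 < κ) (hρ : 64 ≤ ρ) (hC : 0 ≤ C) (hr : 0 < r)
    (hDu : 0 ≤ Du) (hj : 0 ≤ j) (hb : 0 ≤ b) (hN : 0 ≤ Ntot) :
    0 ≤ ewOf κ ρ C r δ Du Dv j b ∧ 0 ≤ wsqOf κ ρ C r δ Du Dv j b ∧ 0 ≤ pyOf κ ρ C r δ Du Dv j b Ntot ∧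
      0 ≤ thetaTwoOf κ ρ C r δ Du Dv j b Ntot := by
  obtain ⟨h1, h2, h3, h4, h5, -⟩ := quinticOf_nonneg (x := 0) (δ := δ) hκ hC hr hDu hj hb le_rfl
  have hρ0 : 0 < ρ := by linarith
  have hρP : 0 < rhoP ρ := by unfold rhoP; linarith
  have hY : 0 < yOf ρ := by unfold yOf; linarith
  have hL : 0 ≤ lcOf κ := by unfold lcOf; positivity
  have hE : 0 ≤ ewOf κ ρ C r δ Du Dv j b := by unfold ewOf; positivity
  have hW : 0 ≤ wsqOf κ ρ C r δ Du Dv j b := by unfold wsqOf; positivity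
  have hP : 0 ≤ pyOf κ ρ C r δ Du Dv j b Ntot := by unfold pyOf; positivity
  have hM : 0 ≤ mshOf C ρ := by unfold mshOf; positivity
  have hJv : 0 ≤ jvOf C r Dv (yOf ρ) := by unfold jvOf; positivity
  refine ⟨hE, hW, hP, ?_⟩
  have h9 : 0 < 1280 * (9 * ρ) + 2388 := by linarith
  unfold thetaTwoOf; positivity

-- the statement names ~20 currencies; gluing five tree theorems with their unfolded forms needs ~3·10⁵ heartbeats
set_option maxHeartbeats 400000 in
include hA hI in
/-- **One scale of the excess-decay induction** (see the module docstring). [folklore] -/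
theorem scale_step (hκ0 : 0 < κ) (hκ1 : κ ≤ 1)
    (hκ : ∀ v : E3 → E3, (Function.support v).Finite →
      Function.support v ⊆ Sites₀ t A → κ * nnForm t A v ≤ ∑' p : Sites₀ t A, ⟪𝕃 v @ p, v p⟫)
    (hX : X.Finite) (hsep : Sep₀ X δ) (hequil : Equil₀ X) (hδ : 0 < δ) (hδ1 : δ ≤ 1)
    (hε0 : 0 ≤ ε) (hε : 2 * ε < δ) (hr : 192 ≤ r)
    (hXb : ∀ p ∈ X, dist p c ≤ r → ∃ m : Fin 2, ∃ z ∈ Λ₀, dist p (t m + A z) ≤ ε)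
    (hπ : ∀ s' ∈ Sites₀ t A, dist s' c ≤ r → π s' ∈ X ∧ dist (π s') s' ≤ ε)
    (hinj : ∀ s₁ ∈ Sites₀ t A, ∀ s₂ ∈ Sites₀ t A, dist s₁ c ≤ r → dist s₂ c ≤ r → π s₁ = π s₂ → s₁ = s₂)
    (SR : Finset E3) (hSR : ∀ x, x ∈ SR ↔ x ∈ Sites₀ t A ∧ dist x c ≤ r)
    (χ : E3 → ℝ) (hχ0 : ∀ q ∈ Sites₀ t A, q ∉ SR → χ q = 0) (hχS : ∀ x, x ∉ Sites₀ t A → χ x = 0)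
    (hχabs : ∀ x, |χ x| ≤ 1) (hχ1abs : ∀ x, |1 - χ x| ≤ 1) (hχone : ∀ q ∈ SR, dist q c ≤ r / 2 → χ q = 1)
    (hχfar : ∀ x ∈ Sites₀ t A, 3 * r / 4 < dist x c → χ x = 0) (hχfin : (Function.support χ).Finite)
    -- the approximant
    (haff : ∀ (m : Fin 2) (z : E3), z ∈ Λ₀ → aff (t m + A z) = a m + B (t m + A z - c₀))
    (hrelax : ∀ s : Sites₀ t A, 𝐆[aff] s = 0)
    (ha' : ‖a 0 - a 1‖ ≤ κ / (2 * 10 ^ 10)) (hB' : ‖B‖ ≤ κ / (2 * 10 ^ 10)) (hBr : 2 * r * ‖B‖ ≤ 1 / 100)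
    (hc₀ : dist c₀ c ≤ r / 8)
    -- the scale and the numerical inputs
    {ρ C Du Dv Ntot : ℝ} (hρ : 64 ≤ ρ) (hρr : 737600 * ρ + 153600 ≤ r) (hC : 0 ≤ C)
    (hDu0 : 0 ≤ Du) (hDu1 : Du ≤ 1 / 20) (hDu : ∀ x ∈ SR, ‖(π x - x) - aff x‖ ≤ Du)
    (hΛκ : 4000000 * lamOf Du ‖a 0 - a 1‖ ‖B‖ ≤ κ / 16)
    (hvD : ∀ x, ‖χ x • ((π x - x) - aff x)‖ ≤ Dv) (hN : 0 ≤ Ntot)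
    (hNNtot : ∀ Xr, NN[(fun x => χ x • ((π x - x) - aff x)), Xr] ≤ Ntot)
    (hmass : ∀ Xr : ℝ, 1 ≤ Xr → ρ ≤ Xr → Xr ≤ r / 4 → 𝐌[(fun x => χ x • ((π x - x) - aff x)), Xr] ≤ 32 * C * Xr ^ 6)
    -- the smallness of the named currencies
    (hs₁ : 12 * Real.sqrt (thetaOneOf κ ρ C r δ Du Dv ‖a 0 - a 1‖ ‖B‖ Ntot) ≤ κ / (2 * 10 ^ 10))
    (hs₂ : jumpOf κ ρ (thetaOneOf κ ρ C r δ Du Dv ‖a 0 - a 1‖ ‖B‖ Ntot) (thetaTwoOf κ ρ C r δ Du Dv ‖a 0 - a 1‖ ‖B‖ Ntot)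
      (Real.sqrt (vsqOf κ ρ C r δ Du Dv ‖a 0 - a 1‖ ‖B‖)) (jhOf κ ρ C r δ Du Dv ‖a 0 - a 1‖ ‖B‖) ≤ κ / (2 * 10 ^ 10))
    (hs₃ : csLip * jumpOf κ ρ (thetaOneOf κ ρ C r δ Du Dv ‖a 0 - a 1‖ ‖B‖ Ntot) (thetaTwoOf κ ρ C r δ Du Dv ‖a 0 - a 1‖ ‖B‖ Ntot)
        (Real.sqrt (vsqOf κ ρ C r δ Du Dv ‖a 0 - a 1‖ ‖B‖)) (jhOf κ ρ C r δ Du Dv ‖a 0 - a 1‖ ‖B‖) +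
      cbLip * (12 * Real.sqrt (thetaOneOf κ ρ C r δ Du Dv ‖a 0 - a 1‖ ‖B‖ Ntot)) ≤ κ ^ 2 / 10 ^ 11) :
    ∃ (z₀ : E3) (aT : Fin 2 → E3) (BT : E3 →L[ℝ] E3) (ξ : E3) (w : E3 → E3),
      z₀ ∈ Λ₀ ∧ dist (t 0 + A z₀) c₀ ≤ 11 / 10 ∧
      ‖BT‖ ≤ 12 * Real.sqrt (thetaOneOf κ ρ C r δ Du Dv ‖a 0 - a 1‖ ‖B‖ Ntot) ∧
      ‖aT 0 - aT 1‖ ≤ κ / (2 * 10 ^ 10) ∧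
      ‖aT 0 - aT 1‖ ≤ jumpOf κ ρ (thetaOneOf κ ρ C r δ Du Dv ‖a 0 - a 1‖ ‖B‖ Ntot) (thetaTwoOf κ ρ C r δ Du Dv ‖a 0 - a 1‖ ‖B‖ Ntot)
        (Real.sqrt (vsqOf κ ρ C r δ Du Dv ‖a 0 - a 1‖ ‖B‖)) (jhOf κ ρ C r δ Du Dv ‖a 0 - a 1‖ ‖B‖) ∧
      (∀ m, ‖aT m‖ ≤ Real.sqrt (vsqOf κ ρ C r δ Du Dv ‖a 0 - a 1‖ ‖B‖) + 11 / 10 * ‖BT‖) ∧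
      ‖ξ‖ ≤ xiOf κ ρ (thetaOneOf κ ρ C r δ Du Dv ‖a 0 - a 1‖ ‖B‖ Ntot) (thetaTwoOf κ ρ C r δ Du Dv ‖a 0 - a 1‖ ‖B‖ Ntot)
        (Real.sqrt (vsqOf κ ρ C r δ Du Dv ‖a 0 - a 1‖ ‖B‖)) (jhOf κ ρ C r δ Du Dv ‖a 0 - a 1‖ ‖B‖) ∧
      (∀ (m : Fin 2) (z : E3), z ∈ Λ₀ →
        (fun x : E3 => aff x + ((if (∃ z ∈ Λ₀, x = t 1 + A z) then aT 1 else aT 0) + BT (x - (t 0 + A z₀))) +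
          (if (∃ z ∈ Λ₀, x = t 0 + A z) then ξ else 0)) (t m + A z) =
          (![a 0 + aT 0 + BT (c₀ - (t 0 + A z₀)) + ξ, a 1 + aT 1 + BT (c₀ - (t 0 + A z₀))] : Fin 2 → E3) m +
            (B + BT) (t m + A z - c₀)) ∧
      (∀ p : Sites₀ t A, 𝐆[fun x : E3 => aff x + ((if (∃ z ∈ Λ₀, x = t 1 + A z) then aT 1 else aT 0) + BT (x - (t 0 + A z₀))) +
          (if (∃ z ∈ Λ₀, x = t 0 + A z) then ξ else 0)] p = 0) ∧
      (Function.support w).Finite ∧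
      ∑' q : Sites₀ t A, ‖w q‖ ^ 2 ≤ wsqOf κ ρ C r δ Du Dv ‖a 0 - a 1‖ ‖B‖ ∧
      (∀ x ∈ Sites₀ t A, dist x c₀ ≤ ρ →
        ‖χ x • ((π x - x) - (aff x + ((if (∃ z ∈ Λ₀, x = t 1 + A z) then aT 1 else aT 0) + BT (x - (t 0 + A z₀))) +
          (if (∃ z ∈ Λ₀, x = t 0 + A z) then ξ else 0))) + w x‖ ^ 2 ≤
          3 * (1428 * Real.sqrt (thetaTwoOf κ ρ C r δ Du Dv ‖a 0 - a 1‖ ‖B‖ Ntot) * (dist x c₀ + 11 / 10) ^ 2) ^ 2 + 3 * ‖ξ‖ ^ 2) := by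
  -- abbreviations
  set j := ‖a 0 - a 1‖ with hj
  set b := ‖B‖ with hb
  have hj0 : 0 ≤ j := norm_nonneg _
  have hb0 : 0 ≤ b := norm_nonneg _
  have hr0 : 0 < r := by linarith
  have hr8 : (8 : ℝ) ≤ r := by linarith
  have hρ1 : (1 : ℝ) ≤ ρ := by linarith
  obtain ⟨hq₁, hq₂, hq₃, hq₄, hq₅, -⟩ := quinticOf_nonneg (x := 0) (δ := δ) hκ0 hC hr0 hDu0 hj0 hb0 le_rfl
  obtain ⟨hEw0, hW0, hPY0, hΘ₂0⟩ := currencies_nonneg (Ntot := Ntot) (δ := δ) hκ0 hρ hC hr0 hDu0 hj0 hb0 hN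
  -- the step field and its elementary properties
  set v : E3 → E3 := fun x => χ x • ((π x - x) - aff x) with hvdef
  set ut : E3 → E3 := fun x => (π x - x) - aff x with hudef
  have hv : (Function.support v).Finite := by
    refine hχfin.subset fun x hx => ?_
    simp only [Function.mem_support, ne_eq] at hx ⊢
    intro h0; apply hx; simp only [hvdef, h0, zero_smul]
  have hsupp' : ∀ x, v x ≠ 0 → x ∈ Sites₀ t A := by
    intro x hx
    by_contra h
    apply hx
    simp only [hvdef, hχS x h, zero_smul]
  have hsupp : ∀ x ∈ Sites₀ t A, 7 * r / 8 < dist x c₀ → v x = 0 := by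
    intro x hx hxd
    have hxc : 3 * r / 4 < dist x c := by
      have := dist_triangle x c c₀
      rw [dist_comm c c₀] at this
      linarith
    simp only [hvdef, hχfar x hx hxc, zero_smul]
  have ha : ‖a 0 - a 1‖ ≤ 1 / 100 := by
    refine ha'.trans ?_
    rw [div_le_div_iff₀ (by positivity) (by norm_num)]; linarith
  have hΛκ' : 4000000 * (210000 * ((25 / 23) * (2 * Du + ‖a 0 - a 1‖) + ‖B‖)) ≤ κ / 16 := by
    unfold lamOf at hΛκ; exact hΛκ
  -- (1) the correction and its energy
  obtain ⟨hφ, w, -, hwfin, hrows, hWE, hE⟩ := step_correction_abs hA hI hκ0 hκ hX hsep hequil hδ hδ1 hε0 hε hr8 hXb hπ hinj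
    SR hSR χ hχ0 hχS hχabs hχ1abs hχone haff hrelax ha hBr v ut hvdef hudef hDu0 hDu1 hDu hΛκ' hv hc₀ _ rfl hC hρ hρr
    hmass hvD hsupp
  have hE' : nnForm t A w ≤ ewOf κ ρ C r δ Du Dv j b := by
    unfold ewOf quinticOf qOf₁ qOf₂ qOf₃ qOf₄ qOf₅ phiOf lamOf rhoP
    exact hE
  have hW' : ∑' q : Sites₀ t A, ‖w q‖ ^ 2 ≤ wsqOf κ ρ C r δ Du Dv j b := by
    refine hWE.trans ?_
    unfold wsqOf
    have h0 : 0 ≤ (400 * rhoP ρ / 189 + 2) ^ 2 := sq_nonneg _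
    have e : rhoP ρ = 2 * (1280 * (9 * ρ) + 2388) + 4 := rfl
    rw [e] at h0 ⊢
    exact mul_le_mul_of_nonneg_left hE' h0
  -- (2) the gradient quintic
  have hsmall : ‖a 0 - a 1‖ + 2 * r * ‖B‖ ≤ 1 / 50 := by linarith
  have hD₀0 : (0 : ℝ) ≤ 2 * Du := by linarith
  have hD₀1 : 2 * Du ≤ 1 / 10 := by linarith
  have hD2 : ∀ x ∈ SR, ‖ut x‖ ≤ 2 * Du / 2 := fun x hx => by have := hDu x hx; simp only [hudef]; linarith
  have hΛκ2 : 4000000 * (210000 * ((25 / 23) * (2 * Du + ‖a 0 - a 1‖) + ‖B‖)) ≤ κ / 16 := hΛκ'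
  have hΦ0 : 0 ≤ phiOf Du r δ := by unfold phiOf; positivity
  have hnear : ∀ a₁, ρ ≤ a₁ → 32 * a₁ ≤ r → NN[v, a₁] ≤ (2 * qOf₁ κ (lamOf Du j b) C) * a₁ + (2 * qOf₂ κ (lamOf Du j b) Dv r) * a₁ ^ 2 +
      (2 * qOf₃ κ (lamOf Du j b) (2 * Du) r) * a₁ ^ 3 + (2 * qOf₄ κ C) * a₁ ^ 4 + qOf₅ κ (phiOf Du r δ) * a₁ ^ 5 := by
    intro a₁ hρa har
    have h := NN_le_poly_abs hA hI hκ0 hκ hX hequil hr8 hπ hinj SR hSR χ hχ0 hχS hχabs hχone haff hD₀0 hD₀1 hsmall v ut hvdef hudef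
      hD2 hΛκ2 hv hc₀ _ rfl hΦ0 (by unfold phiOf; exact hφ) hC hmass hvD hsupp (hρ1.trans hρa) hρa har
    unfold qOf₁ qOf₂ qOf₃ qOf₄ qOf₅ lamOf phiOf
    unfold phiOf at h
    linarith [h]
  -- (3) the base values of h = v + w by the harmonic sup estimate
  have hρP4 : 4 * (2 * (1280 * (9 * ρ) + 2388) + 4) + 4 ≤ r / 4 := by linarith
  have hMsh : 𝐌[v, 4 * (1280 * (9 * ρ) + 2388) + 4] ≤ mshOf C ρ := by
    have h := hmass (4 * (2 * (1280 * (9 * ρ) + 2388) + 4) + 4) (by linarith) (by linarith) hρP4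
    unfold mshOf rhoP
    exact le_trans (mass_mono hA hI v (by linarith)) h
  have hRs : (1 : ℝ) ≤ 7 * r / 8 := by linarith
  have hRe : (0 : ℝ) < r / 4 := by linarith
  have hJv : 𝐉[v, 10 * ρ + 10] ≤ jvOf C r Dv (10 * ρ + 10) := by
    unfold jvOf
    exact farMass_le_mass hA hI v hv hC hRs hRe hmass hvD hsupp hsupp' (by linarith) (by linarith)
  have hVf : ∀ x ∈ Sites₀ t A, dist x c₀ ≤ 11 / 5 → ‖(fun x => v x + w x) x‖ ≤ Real.sqrt (vsqOf κ ρ C r δ Du Dv j b) := by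
    intro x hx hxd
    have h := step_values hA hI hκ0 hκ v w hv hwfin hρ hrows hMsh hJv hW' hx (by linarith)
    unfold vsqOf lcOf
    exact h
  -- (4) the induction step
  have hJ : 2 * (4096 * C / ρ ^ 2 + 8192 * (7 * r / 8) ^ 3 * Dv ^ 2 / ((r / 4) ^ 7 * ρ)) +
      2 * ρ⁻¹ ^ 8 * wsqOf κ ρ C r δ Du Dv j b ≤ jhOf κ ρ C r δ Du Dv j b := by unfold jhOf; exact le_rfl
  have h2q₁ : 0 ≤ 2 * qOf₁ κ (lamOf Du j b) C := by positivity
  have h2q₂ : 0 ≤ 2 * qOf₂ κ (lamOf Du j b) Dv r := by positivity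
  have h2q₃ : 0 ≤ 2 * qOf₃ κ (lamOf Du j b) (2 * Du) r := by positivity
  have h2q₄ : 0 ≤ 2 * qOf₄ κ C := by positivity
  obtain ⟨z₀, aT, BT, ξ, hz₀, hp₀c, hBT, hjump', hjump, hval, hξ, haff', hrel', henv'⟩ :=
    induction_step₃ hA hI hκ0 hκ1 hκ hr SR hSR χ hχone haff hrelax ha' hB' v ut w hvdef hudef hv hwfin hc₀ hC hρ hρr hN
      h2q₁ h2q₂ h2q₃ h2q₄ hq₅ hmass hvD hsupp hsupp' hMsh hnear hNNtot hrows hW' hE' hEw0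
      (yOf ρ) (pyOf κ ρ C r δ Du Dv j b Ntot) (lcOf κ) csLip cbLip rfl rfl rfl rfl rfl
      (Θ₁ := thetaOneOf κ ρ C r δ Du Dv j b Ntot) (by unfold thetaOneOf; exact le_rfl)
      (Θ₂ := thetaTwoOf κ ρ C r δ Du Dv j b Ntot) (by unfold thetaTwoOf; exact le_rfl) hΘ₂0 hVf hJ hs₁
      (by unfold jumpOf at hs₂; exact hs₂) (by unfold jumpOf csLip cbLip at hs₃; exact hs₃)
  have hjumpOf : ‖aT 0 - aT 1‖ ≤ jumpOf κ ρ (thetaOneOf κ ρ C r δ Du Dv j b Ntot) (thetaTwoOf κ ρ C r δ Du Dv j b Ntot)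
      (Real.sqrt (vsqOf κ ρ C r δ Du Dv j b)) (jhOf κ ρ C r δ Du Dv j b) := by
    unfold jumpOf; exact hjump
  have hcs0 : 0 ≤ csLip := by unfold csLip; positivity
  have hcb0 : 0 ≤ cbLip := by unfold cbLip; positivity
  have hξOf : ‖ξ‖ ≤ xiOf κ ρ (thetaOneOf κ ρ C r δ Du Dv j b Ntot) (thetaTwoOf κ ρ C r δ Du Dv j b Ntot)
      (Real.sqrt (vsqOf κ ρ C r δ Du Dv j b)) (jhOf κ ρ C r δ Du Dv j b) := by
    unfold xiOf
    refine hξ.trans (mul_le_mul_of_nonneg_left ?_ (by positivity))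
    exact add_le_add (mul_le_mul_of_nonneg_left hjumpOf hcs0) (mul_le_mul_of_nonneg_left hBT hcb0)
  refine ⟨z₀, aT, BT, ξ, w, hz₀, hp₀c, hBT, hjump', hjumpOf, hval, hξOf, haff', hrel', hwfin, hW', ?_⟩
  intro x hx hxd
  exact henv' x hx hxd

end

end Summit.AtomisticToContinuum.Crystallization.Theorems.ExcessDecayLiouville

end
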